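import Literature.Topology.FourManifolds.SphereMorseCount
import Literature.AlgebraicTopology.SingularHomology.FundamentalClassProofs
import Literature.AlgebraicTopology.SingularHomology.CompactManifoldFiniteness
import Literature.AlgebraicTopology.SingularHomology.CellsAttachmentEuler
import HarnessLib

/-!
# The Morse count of a closed connected surface is at most two

For a Morse function `f` on a closed connected smooth surface `S`,

  `#minima − #saddles + #maxima ≤ 2`,

i.e. `χ(S) ≤ 2` in the Morse-theoretic form in which the Gauss–Bonnet argument of
Huisken–Ilmanen (2001), §5 ("by the Gauss–Bonnet formula, provided that `N_t` is connected")
consumes it (`Literature.Geometry.Lorentzian.geroch_monotonicity_smooth`). Everything here is a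
short combination of results already PROVED in the tree:

* the Morse equality for every Morse function on a closed manifold,
  `Σ_k (−1)^k #Crit_k(f) = χ(S) = Σ_k (−1)^k rank H_k(S; ℤ)`
  (`SphereMorseCount.morseCount_eq_relEuler`, Milnor 1965, §3 and Thm. 7.4; Hirsch 1976, Ch. 6,
  Thm. 3.5), with `H_•(S; ℤ)` finitely generated and zero above the dimension
  (`finite_singularHomology_of_compactSpace_holds`, `isZero_singularHomology_of_lt_holds`,
  Hatcher 2002, Cor. A.8–A.9, Lemma 3.27);
* `rank H₀(S; ℤ) = 1` for a path-connected space (Hatcher 2002, Prop. 2.7,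
  `finrank_singularHomology_zero_of_pathConnectedSpace`);
* `rank H₂(S; ℤ) ≤ 1`: `H₂(S; ℤ) → H₂(S | x; ℤ) ≅ ℤ` is injective on a closed connected surface
  (Hatcher 2002, Thm. 3.26 (b) and p. 231;
  `singularHomology.toLocal_injective_of_connectedSpace_holds`, `nonempty_localHomology_iso_holds'`).

Hence `#Crit₀ − #Crit₁ + #Crit₂ = b₀ − b₁ + b₂ ≤ 1 + 1 = 2` (`morseCount_surface_le_two`).
No definitions, no named facts.

## References

* J. Milnor, *Lectures on the h-cobordism theorem*, Princeton 1965, §3 and Thm. 7.4.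
  [MilnorHCobordism1965]
* A. Hatcher, *Algebraic Topology*, CUP 2002, Prop. 2.7, Thm. 3.26, p. 231, Cor. A.8–A.9.
  [HatcherAT2002]
* G. Huisken, T. Ilmanen, *The inverse mean curvature flow and the Riemannian Penrose
  inequality*, J. Differential Geom. 59 (2001), §5 (use of `χ(N_t) ≤ 2`). [HuiskenIlmanenIMCF2001]
-/

noncomputable section

open Set Function CategoryTheory
open scoped Manifold ContDiff Topology
open Literature.AlgebraicTopology.SingularHomology

namespace Literature.Topology.FourManifolds

universe u

variable {S : Type u} [TopologicalSpace S] [T2Space S] [CompactSpace S]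
  [ChartedSpace (EuclideanSpace ℝ (Fin 2)) S]

/-- **`rank H₂(S; ℤ) ≤ 1` for a closed connected surface**: `H₂(S; ℤ) → H₂(S | x; ℤ)` is
injective (Hatcher 2002, Thm. 3.26 (b)) and `H₂(S | x; ℤ) ≅ ℤ` (Hatcher 2002, p. 231).
[cite: HatcherAT2002, Thm. 3.26 (b) and §3.3 p. 231] -/
theorem finrank_singularHomology_two_le_one [ConnectedSpace S] [Nonempty S] :
    Module.finrank ℤ (singularHomology ℤ ℤ S 2) ≤ 1 := by
  obtain ⟨x⟩ := (inferInstance : Nonempty S)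
  obtain ⟨e⟩ := nonempty_localHomology_iso_holds' ℤ S x (n := 2)
  have hinj : Function.Injective (singularHomology.toLocal ℤ ℤ x 2) :=
    singularHomology.toLocal_injective_of_connectedSpace_holds ℤ ℤ (X := S) 2 x
  haveI : Module.Finite ℤ (localHomology ℤ ℤ S x 2) :=
    Module.Finite.equiv e.toLinearEquiv.symm
  have h1 : Module.finrank ℤ (localHomology ℤ ℤ S x 2) = 1 := by
    rw [e.toLinearEquiv.finrank_eq]
    change Module.finrank ℤ (ULift.{u} ℤ) = 1
    rw [finrank_ulift, Module.finrank_self]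
  calc Module.finrank ℤ (singularHomology ℤ ℤ S 2)
      ≤ Module.finrank ℤ (localHomology ℤ ℤ S x 2) :=
        LinearMap.finrank_le_finrank_of_injective (f := (singularHomology.toLocal ℤ ℤ x 2).hom) hinj
    _ = 1 := h1

/-- **The Euler characteristic of a closed connected surface is at most `2`**:
`χ(S) = rank H₀ − rank H₁ + rank H₂ ≤ 1 + 1` (Hatcher 2002, Prop. 2.7, Thm. 3.26 (b), Lemma 3.27,
Cor. A.8–A.9). [cite: HatcherAT2002, Prop. 2.7 and Thm. 3.26 (b)] -/
theorem relEuler_surface_le_two [ConnectedSpace S] [Nonempty S] : relEuler ℤ ℤ S ∅ ≤ 2 := by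
  have hfin : FinRelHomology ℤ ℤ S ∅ 3 :=
    FinRelHomology.empty_of_absolute
      (fun j => finite_singularHomology_of_compactSpace_holds ℤ S 2 j)
      (fun _ hj => isZero_singularHomology_of_lt_holds ℤ ℤ S 2 (by omega))
  haveI : LocallyPathConnectedSpace S :=
    ChartedSpace.locallyPathConnectedSpace (EuclideanSpace ℝ (Fin 2)) S
  haveI : PathConnectedSpace S := pathConnectedSpace_iff_connectedSpace.mpr inferInstance
  have h0 : Module.finrank ℤ (singularHomology ℤ ℤ S 0) = 1 := by
    rw [finrank_singularHomology_zero_of_pathConnectedSpace ℤ ℤ (X := S), Module.finrank_self]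
  have h2 := finrank_singularHomology_two_le_one (S := S)
  rw [hfin.relEuler_empty_eq_sum]
  simp only [Finset.sum_range_succ, Finset.sum_range_zero, h0]
  push_cast
  omega

/-- **The Morse count of a closed connected surface is at most two**: for a Morse function `f`
on a closed connected smooth surface, `#Crit₀(f) − #Crit₁(f) + #Crit₂(f) ≤ 2` — the Morse
equality `Σ_k (−1)^k #Crit_k = χ(S)` (Milnor 1965, §3, Thm. 7.4; the tree's
`SphereMorseCount.morseCount_eq_relEuler`) and `χ(S) ≤ 2` (`relEuler_surface_le_two`). This is
the topological input "`χ(N_t) ≤ 2` provided `N_t` is connected" of the Gauss–Bonnet step of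
Geroch monotonicity (Huisken–Ilmanen 2001, §5).
[cite: MilnorHCobordism1965, §3 (PDF p. 21) and Thm. 7.4 (PDF p. 48)]
[cite: HuiskenIlmanenIMCF2001, §5, Geroch Monotonicity] -/
theorem morseCount_surface_le_two [SecondCountableTopology S] [ConnectedSpace S]
    [IsManifold (𝓡 2) ∞ S] {f : S → ℝ}
    (hf : IsMorse (𝓡 2) f) :
    ((criticalSetOfIndex (𝓡 2) f 0).ncard : ℤ) - (criticalSetOfIndex (𝓡 2) f 1).ncard
      + (criticalSetOfIndex (𝓡 2) f 2).ncard ≤ 2 := by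
  have h := SphereMorseCount.morseCount_eq_relEuler (n := 1) hf
  haveI : Nonempty S := ConnectedSpace.toNonempty
  have hle := relEuler_surface_le_two (S := S)
  simp only [Finset.sum_range_succ, Finset.sum_range_zero] at h
  push_cast at h
  linarith

end Literature.Topology.FourManifolds
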